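import Summits.NavierStokesRegularity.FunctionalMining.CrossedShearHessians
import HarnessLib

/-!
# FunctionalMining — kernel no-go: the rows `EP.Pidev.q|T_LD|G1` are FALSE for every κ at every real `q > 1` (W11)

Search for candidate a priori estimates; no regularity claim. Cell `pub-nsfunc`, prove seat
(gen 11). SIEVELD §2, Corollary W11 for the cores `∫|Π^dev|^q`, REAL `q > 1` (K0 rows
`EP.Pidev.q=3/2`, `σ_F = 3, γ_F = 2`, and `EP.Pidev.q=2`, `σ_F = 5, γ_F = 9/5`). At the reciprocal
crossed shear `u_β` (`π = cc = C(x₀)C(x₁)`, `Δ⁻¹A = −8π² G`, `G = g_β(x₂) cc`) the deviatoric Hessians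
`H = D²_dev cc` and `D = D²_dev G` are explicit (file `CrossedShearHessians`; `C = cos 2π·`, `S = sin 2π·`):

`H₀₀ = H₁₁ = −(4/3)π² cc`, `H₂₂ = (8/3)π² cc`, `H₀₁ = 4π² S(x₀)S(x₁)`, `H₀₂ = H₁₂ = 0`,
`∑ᵢⱼ Hᵢⱼ Dᵢⱼ = g_β(x₂) |H|² + (8/3)π² g_β″(x₂) cc²`, `|H|² = (32/3)π⁴ cc² + 32π⁴ S(x₀)²S(x₁)²`,

so the viscous rate of `∫|Π^dev|^q` (`pidevRpowViscousRate`, file `PidevMomentRateRpow`) is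
`V_q(u_β) = 4π² q (β² − 2) M_q + ∫ cos 4πx₂ · R(x₀, x₁) = 4π² q (β² − 2) M_q`, `M_q = ∫ |H|^q > 0`
(the `cos 4πx₂`-part — from `g_β = −(β²−2)/2 + (β²/6)cos 4πx₂` and `g_β″ ∝ cos 4πx₂` — integrates to
zero by the translation `x₂ ↦ x₂ + 1/4`). At `β = 2`, `V_q = 8π² q M_q > 0` and Theorem H (`HeatSieve`)
kills `SaturatingLaw (∫|Π^dev|^q) σ γ κ` for every `κ`, `σ`, `γ ≥ 0`, every real `q > 1` — in
particular the rows `EP.Pidev.q=3/2|T_LD|G1` (`(σ,γ) = (3,2)`) and `EP.Pidev.q=2|T_LD|G1` at its own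
exponents `(5, 9/5)` (referee F56.3). Explicit-witness no-go; nothing about regularity.
-/

noncomputable section

open MeasureTheory Set Filter Topology Real
open scoped InnerProductSpace RealInnerProductSpace ContDiff

namespace Summit.NavierStokesRegularity.FunctionalMining

open Literature.Analysis Literature.Analysis.FunctionSpaces Literature.Analysis.FunctionSpaces.Torus
open Literature.Analysis.FluidPDE

namespace CrossedShear

/-! ## 2. The viscous rate of `∫|Π^dev|^q` at the crossed shear -/

/-- `D²_dev (c θ) = c D²_dev θ` for smooth `θ`. [folklore] -/
theorem hessDev_const_smul {θ : UnitAddTorus (Fin 3) → ℝ} (hθ : IsSmooth θ) (c : ℝ) (i j : Fin 3)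
    (x : UnitAddTorus (Fin 3)) : hessDev (c • θ) i j x = c * hessDev θ i j x := by
  have h1 : ∀ k, Torus.partialDeriv k (c • θ) = c • Torus.partialDeriv k θ := fun k =>
    Torus.partialDeriv_const_smul (hθ.isContDiff (by simp)) c k
  have h2 : ∀ l k y, Torus.partialDeriv l (Torus.partialDeriv k (c • θ)) y =
      c * Torus.partialDeriv l (Torus.partialDeriv k θ) y := by
    intro l k y
    rw [h1 k, Torus.partialDeriv_const_smul ((hθ.partialDeriv k).isContDiff (by simp)), Pi.smul_apply,
      smul_eq_mul]
  simp only [hessDev, h2, ← Finset.mul_sum]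
  ring

/-- `Π^dev` of the crossed shear is `D²_dev cc`. [ours] -/
theorem pidev_cshear (β : ℝ) (i j : Fin 3) (x : UnitAddTorus (Fin 3)) :
    pidev (cshear β) i j x = hessDev cc i j x := by
  rw [pidev_eq_hessDev, pressureOf_cshear]

/-- `r^{(q−2)/2} r = r^{q/2}` for `r ≥ 0`, `q ≠ 0`. [folklore] -/
theorem rpow_half_sub_one_mul {r q : ℝ} (hr : 0 ≤ r) (hq : q ≠ 0) : r ^ ((q - 2) / 2) * r = r ^ (q / 2) := by
  have h : (q - 2) / 2 + 1 = q / 2 := by ring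
  rw [← h, Real.rpow_add' hr (by rw [h]; exact div_ne_zero hq two_ne_zero), Real.rpow_one]

/-- The integrand of `V_q` at the crossed shear, pointwise:
`q|H|^{q−2} ∑ Hᵢⱼ D²_dev(Δ⁻¹A)ᵢⱼ = −8π² q (g_β(x₂)|H|^q + (8/3)π² g_β″(x₂) cc² |H|^{q−2})`. [ours; elementary] -/
theorem pidevRpowViscousRate_integrand_cshear (β : ℝ) {q : ℝ} (hq : 0 < q) (x : UnitAddTorus (Fin 3)) :
    q * (∑ i, ∑ j, pidev (cshear β) i j x ^ 2) ^ ((q - 2) / 2) *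
        ∑ i, ∑ j, pidev (cshear β) i j x *
          hessDev (Torus.invLaplacian (pressureSqViscousSource (cshear β))) i j x =
      -(8 * π ^ 2) * q *
        ((gP β).onCircle (x 2) * (∑ i, ∑ j, hessDev cc i j x ^ 2) ^ (q / 2) +
          8 / 3 * π ^ 2 * (gP β).D.D.onCircle (x 2) * cc x ^ 2 *
            (∑ i, ∑ j, hessDev cc i j x ^ 2) ^ ((q - 2) / 2)) := by
  have hsrc : pressureSqViscousSource (cshear β) = (-(8 * π ^ 2)) • fun x => heatProfile β (x 2) * cc x := by
    funext y; rw [pressureSqViscousSource_cshear]; simp [smul_eq_mul]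
  have hsm : IsSmooth (fun x : UnitAddTorus (Fin 3) => heatProfile β (x 2) * cc x) := by
    have e : (fun x : UnitAddTorus (Fin 3) => heatProfile β (x 2) * cc x) = Torus.laplacian (Gfun β) := by
      funext y; rw [laplacian_Gfun]
    rw [e]; exact (isSmooth_Gfun β).laplacian
  simp_rw [pidev_cshear]
  rw [hsrc, Torus.invLaplacian_const_smul _ _ hsm, invLaplacian_heat_cc]
  simp_rw [hessDev_const_smul (isSmooth_Gfun β)]
  have e2 : ∑ i, ∑ j, hessDev cc i j x * (-(8 * π ^ 2) * hessDev (Gfun β) i j x) =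
      -(8 * π ^ 2) * ∑ i, ∑ j, hessDev cc i j x * hessDev (Gfun β) i j x := by
    simp_rw [Finset.mul_sum]
    exact Finset.sum_congr rfl fun i _ => Finset.sum_congr rfl fun j _ => by ring
  rw [e2, sum_hessDev_cc_mul_hessDev_Gfun]
  have hN : 0 ≤ ∑ i, ∑ j, hessDev cc i j x ^ 2 :=
    Finset.sum_nonneg fun i _ => Finset.sum_nonneg fun j _ => sq_nonneg _
  have hpow := rpow_half_sub_one_mul hN hq.ne'
  calc q * (∑ i, ∑ j, hessDev cc i j x ^ 2) ^ ((q - 2) / 2) *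
        (-(8 * π ^ 2) * ((gP β).onCircle (x 2) * ∑ i, ∑ j, hessDev cc i j x ^ 2 +
          8 / 3 * π ^ 2 * (gP β).D.D.onCircle (x 2) * cc x ^ 2))
      = -(8 * π ^ 2) * q * ((gP β).onCircle (x 2) *
          ((∑ i, ∑ j, hessDev cc i j x ^ 2) ^ ((q - 2) / 2) * ∑ i, ∑ j, hessDev cc i j x ^ 2) +
          8 / 3 * π ^ 2 * (gP β).D.D.onCircle (x 2) * cc x ^ 2 *
            (∑ i, ∑ j, hessDev cc i j x ^ 2) ^ ((q - 2) / 2)) := by ring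
    _ = _ := by rw [hpow]

/-- `g_β″ = −(8/3)π²β² cos 4πt` on the circle. [folklore] -/
theorem gP_DD_onCircle (β : ℝ) (b : UnitAddCircle) :
    (gP β).D.D.onCircle b = -(8 / 3 * π ^ 2 * β ^ 2) * cos2P.onCircle b := by
  obtain ⟨t, rfl⟩ := QuotientAddGroup.mk_surjective b
  rw [ShearProfile.onCircle_coe, ShearProfile.onCircle_coe, ShearProfile.D_apply, ShearProfile.coe_D,
    deriv_deriv_gP]
  ring

/-- `x ↦ |H|^{r}` (`r ≥ 0`) is continuous. [folklore] -/
theorem continuous_sum_hessDev_cc_sq_rpow {r : ℝ} (hr : 0 ≤ r) :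
    Continuous fun x : UnitAddTorus (Fin 3) => (∑ i, ∑ j, hessDev cc i j x ^ 2) ^ r := by
  have hc : Continuous fun x : UnitAddTorus (Fin 3) => ∑ i, ∑ j, hessDev cc i j x ^ 2 :=
    continuous_finsetSum _ fun i _ => continuous_finsetSum _ fun j _ =>
      ((isSmooth_hessDev isSmooth_cc i j).continuous).pow 2
  exact hc.rpow_const fun _ => Or.inr hr

/-- **The oscillatory part integrates to zero**: for the `x₂`-independent remainder `R`,
`∫ cos 4πx₂ · R(x) dx = 0` (translation `x₂ ↦ x₂ + 1/4`). [ours; elementary] -/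
theorem integral_cos2P_mul_eq_zero {R : UnitAddTorus (Fin 3) → ℝ}
    (hR : ∀ x c, R (x + Pi.single 2 c) = R x) :
    ∫ x : UnitAddTorus (Fin 3), cos2P.onCircle (x 2) * R x = 0 := by
  set F : UnitAddTorus (Fin 3) → ℝ := fun x => cos2P.onCircle (x 2) * R x with hF
  set e : UnitAddTorus (Fin 3) := Pi.single 2 ((1 / 4 : ℝ) : UnitAddCircle) with he
  have h1 : ∫ x, F (x + e) = ∫ x, F x := integral_add_right_eq_self F e
  have h2 : ∀ x, F (x + e) = -F x := by
    intro x
    simp only [hF]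
    rw [he, hR]
    have : (x + Pi.single (2 : Fin 3) ((1 / 4 : ℝ) : UnitAddCircle) : UnitAddTorus (Fin 3)) 2 =
        x 2 + ((1 / 4 : ℝ) : UnitAddCircle) := by simp
    rw [this, cos2P_onCircle_add_quarter]
    ring
  simp_rw [h2, integral_neg] at h1
  show ∫ x, F x = 0
  linarith

/-- **`V_q(u_β) = 4π² q (β² − 2) M_q`**, `M_q = ∫ |H|^q = ∫ (∑ᵢⱼ (D²_dev cc)ᵢⱼ²)^{q/2}`, real `q > 1`.
[ours] -/
theorem pidevRpowViscousRate_cshear (β : ℝ) {q : ℝ} (hq : 1 < q) :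
    pidevRpowViscousRate q (cshear β) =
      4 * π ^ 2 * q * (β ^ 2 - 2) * ∫ x : UnitAddTorus (Fin 3), (∑ i, ∑ j, hessDev cc i j x ^ 2) ^ (q / 2) := by
  have hq0 : 0 < q := by linarith
  -- integrability of the full integrand (it is continuous: `continuous_pidevRpowIntegrand`)
  have hsrc : IsSmooth (pressureSqViscousSource (cshear β)) := isSmooth_pressureSqViscousSource (isSmooth_cshear β)
  have itot : Integrable fun x : UnitAddTorus (Fin 3) =>
      q * (∑ i, ∑ j, pidev (cshear β) i j x ^ 2) ^ ((q - 2) / 2) *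
        ∑ i, ∑ j, pidev (cshear β) i j x *
          hessDev (Torus.invLaplacian (pressureSqViscousSource (cshear β))) i j x :=
    (continuous_pidevRpowIntegrand hq (isSmooth_cshear β) (Torus.isSmooth_invLaplacian hsrc)).integrable_unitAddTorus
  unfold pidevRpowViscousRate
  -- split into the mean part and the oscillatory part
  set N : UnitAddTorus (Fin 3) → ℝ := fun x => ∑ i, ∑ j, hessDev cc i j x ^ 2 with hN
  set R : UnitAddTorus (Fin 3) → ℝ := fun x =>
    -(8 * π ^ 2) * q * (β ^ 2 / 6 * N x ^ (q / 2) +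
      8 / 3 * π ^ 2 * (-(8 / 3 * π ^ 2 * β ^ 2)) * cc x ^ 2 * N x ^ ((q - 2) / 2)) with hRdef
  have e : ∀ x : UnitAddTorus (Fin 3),
      q * (∑ i, ∑ j, pidev (cshear β) i j x ^ 2) ^ ((q - 2) / 2) *
        ∑ i, ∑ j, pidev (cshear β) i j x *
          hessDev (Torus.invLaplacian (pressureSqViscousSource (cshear β))) i j x =
      4 * π ^ 2 * q * (β ^ 2 - 2) * N x ^ (q / 2) + cos2P.onCircle (x 2) * R x := by
    intro x
    rw [pidevRpowViscousRate_integrand_cshear β hq0, gP_onCircle, gP_DD_onCircle]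
    simp only [hRdef, hN]
    ring
  have i1 : Integrable fun x : UnitAddTorus (Fin 3) => 4 * π ^ 2 * q * (β ^ 2 - 2) * N x ^ (q / 2) :=
    ((continuous_sum_hessDev_cc_sq_rpow (by linarith : 0 ≤ q / 2)).const_mul _).integrable_unitAddTorus
  have i2 : Integrable fun x : UnitAddTorus (Fin 3) => cos2P.onCircle (x 2) * R x := by
    have h := itot.sub i1
    refine h.congr (ae_of_all _ fun x => ?_)
    simp only [Pi.sub_apply]
    rw [e x]
    ring
  simp_rw [e]
  rw [integral_add i1 i2, integral_const_mul]
  have hR : ∀ x c, R (x + Pi.single 2 c) = R x := by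
    intro x c
    have h0 : (x + Pi.single (2 : Fin 3) c : UnitAddTorus (Fin 3)) 0 = x 0 := by simp
    have h1 : (x + Pi.single (2 : Fin 3) c : UnitAddTorus (Fin 3)) 1 = x 1 := by simp
    have hc : cc (x + Pi.single (2 : Fin 3) c) = cc x := by rw [cc, cc, h0, h1]
    simp only [hRdef, hN]
    rw [sum_hessDev_cc_sq_add_single_two, hc]
  rw [integral_cos2P_mul_eq_zero hR, add_zero]

/-- **`M_q = ∫ |H|^q > 0`** (`|H|² ≥ H₂₂² = (64/9)π⁴` at the origin). [folklore] -/
theorem integral_sum_hessDev_cc_sq_rpow_pos {q : ℝ} (hq : 0 < q) :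
    0 < ∫ x : UnitAddTorus (Fin 3), (∑ i, ∑ j, hessDev cc i j x ^ 2) ^ (q / 2) := by
  have hc := continuous_sum_hessDev_cc_sq_rpow (by linarith : 0 ≤ q / 2)
  have h0 : ∀ x : UnitAddTorus (Fin 3), 0 ≤ (∑ i, ∑ j, hessDev cc i j x ^ 2) ^ (q / 2) := fun x =>
    Real.rpow_nonneg (Finset.sum_nonneg fun i _ => Finset.sum_nonneg fun j _ => sq_nonneg _) _
  rw [integral_pos_iff_support_of_nonneg h0 (hc.integrable_of_hasCompactSupport
    (HasCompactSupport.of_compactSpace _))]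
  set xs : UnitAddTorus (Fin 3) := fun _ => ((0 : ℝ) : UnitAddCircle) with hxs
  refine (hc.isOpen_support).measure_pos volume ⟨xs, ?_⟩
  rw [Function.mem_support]
  have hC : cosP.onCircle ((0 : ℝ) : UnitAddCircle) = 1 := by
    rw [ShearProfile.onCircle_coe, cosP_apply, mul_zero, Real.cos_zero]
  have hS : sinP.onCircle ((0 : ℝ) : UnitAddCircle) = 0 := by
    rw [ShearProfile.onCircle_coe, sinP_apply, mul_zero, Real.sin_zero]
  have hcc : cc xs = 1 := by
    show cosP.onCircle ((0 : ℝ) : UnitAddCircle) * cosP.onCircle ((0 : ℝ) : UnitAddCircle) = 1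
    rw [hC, mul_one]
  have hss : sinP.onCircle (xs 0) * sinP.onCircle (xs 1) = 0 := by
    show sinP.onCircle ((0 : ℝ) : UnitAddCircle) * sinP.onCircle ((0 : ℝ) : UnitAddCircle) = 0
    rw [hS, zero_mul]
  have hN : ∑ i, ∑ j, hessDev cc i j xs ^ 2 = 32 / 3 * π ^ 4 := by
    rw [sum_hessDev_cc_sq, hcc, hss]; ring
  rw [hN]
  have hpos : (0 : ℝ) < 32 / 3 * π ^ 4 := by positivity
  exact (Real.rpow_pos_of_pos hpos _).ne'

/-! ## 3. The no-go for every real `q > 1` -/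

/-- **Kernel no-go (SIEVELD §1–§2): `∫|Π^dev|^q` obeys NO saturating law, real `q > 1`.** For every
`κ`, every `σ` and every `γ ≥ 0`, `SaturatingLaw (torusPidevMoment q) σ γ κ` fails on `T³` — at the
crossed shear `u₂` the viscous initial rate of `∫|Π^dev|^q` is `V_q = 8π² q M_q > 0` (Theorem H,
`HeatSieve`). In particular the K0 rows `EP.Pidev.q=3/2|T_LD|G1` (`σ = 3`, `γ = 2`) and
`EP.Pidev.q=2|T_LD|G1` (`σ = 5`, `γ = 9/5`) are FALSE for every κ. Search for candidate a priori
estimates; no regularity claim. [ours; SIEVELD §1 Thm H, §2 Cor. W11] -/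
theorem not_saturatingLaw_pidevMoment_rpow {q : ℝ} (hq : 1 < q) {σ γ : ℝ} (hγ : 0 ≤ γ) (κ : ℝ) :
    ¬ SaturatingLaw (d := Fin 3) (torusPidevMoment q) σ γ κ := by
  have hq0 : 0 < q := by linarith
  have hM := integral_sum_hessDev_cc_sq_rpow_pos hq0
  have hV : 0 < pidevRpowViscousRate q (cshear 2) := by
    rw [pidevRpowViscousRate_cshear 2 hq]
    have hπ2 : (0 : ℝ) < π ^ 2 := by positivity
    have : (0 : ℝ) < 4 * π ^ 2 * q * ((2 : ℝ) ^ 2 - 2) := by nlinarith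
    exact mul_pos this hM
  exact not_saturatingLaw_of_viscousRate_pos (hasInitialRate_torusPidevMoment_rpow hq) (by simp)
    (isSmooth_cshear 2) (isDivFree_cshear 2) (hasZeroMean_cshear 2) hV hγ κ

/-- **Row `EP.Pidev.q=3/2|T_LD|G1` (K0: `σ_F = 3`, `γ_F = 2`) is FALSE for every κ.** [ours] -/
theorem not_saturatingLaw_pidevMoment_three_halves_row (κ : ℝ) :
    ¬ SaturatingLaw (d := Fin 3) (torusPidevMoment (3 / 2)) 3 2 κ :=
  not_saturatingLaw_pidevMoment_rpow (by norm_num) (by norm_num) κ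

/-- **Row `EP.Pidev.q=2|T_LD|G1` at ITS OWN exponents (K0: `σ_F = 5`, `γ_F = 9/5`) is FALSE for every κ**
(the literal row decl asked for by referee F56.3; `CrossedShearPidev.not_saturatingLaw_pidevMoment_two_row`
carries the `∇π`-row pair `(3, 7/3)` and is also true). [ours] -/
theorem not_saturatingLaw_pidevMoment_two_row' (κ : ℝ) :
    ¬ SaturatingLaw (d := Fin 3) (torusPidevMoment 2) 5 (9 / 5) κ :=
  not_saturatingLaw_pidevMoment_rpow (by norm_num) (by norm_num) κ

end CrossedShear

end Summit.NavierStokesRegularity.FunctionalMining
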